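import Summits.ResolutionOfSingularities.ResolutionOfSingularities.Theorems.FrobeniusClosingSteerNoTangentialStep
import Summits.ResolutionOfSingularities.ResolutionOfSingularities.Theorems.FrobeniusClosingSteerNoSatelliteStepWindow
import Summits.ResolutionOfSingularities.ResolutionOfSingularities.Theorems.FrobeniusClosingSteerNoSatelliteStepSupport
import Summits.ResolutionOfSingularities.ResolutionOfSingularities.Theorems.FrobeniusClosingSteerNoSatelliteStepFrames
import Summits.ResolutionOfSingularities.ResolutionOfSingularities.Theorems.FrobeniusClosingSteerAdaptedCohenFrame
import Summits.ResolutionOfSingularities.ResolutionOfSingularities.Theorems.FrobeniusClosingSteerExpansionTransport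
import Summits.ResolutionOfSingularities.ResolutionOfSingularities.Theorems.FrobeniusClosingSteerChartRealisability
import Summits.ResolutionOfSingularities.ResolutionOfSingularities.Theorems.FrobeniusClosingSteerRadicandNonIsolatedOfOddSupport
import Summits.ResolutionOfSingularities.ResolutionOfSingularities.Theorems.FrobeniusClosingSteerRadicandRenormalisation
import Summits.ResolutionOfSingularities.ResolutionOfSingularities.Theorems.FrobeniusClosingSteerFreeChainBound
import Mathlib.Algebra.CharP.Subring
import HarnessLib

/-!
# Crux `Steer` (stmt-ResolutionOfSingularities-16345), chain W4.1: **LEMMA S — NO SATELLITE STEP** at constant cleaned order `2e ≥ 4` for isolated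
# `2`-radicands with perfect residue fields (the kernel `…NoSatelliteStep`, signature (LS) + `hexc₁`; closes hNT4's kernel at `c = 4` and, with
# `FreeChainBound.not_eternal_free_rational_chain`, the rational case of G-perf(c))

OURS (campaign `res-hironaka`, rung L ★L-G4, slot W4.1; seat res-L0-w41-stub-2 g6 = Lemma S heir by res-L0-w41-plan-1 RULINGs 147c/163a/181c; signature
of record `D/res-D-pv-004/work/gen5/nt4/SigLemmaS-NoSatelliteStep.lean` 96899564e47a0ca4 + `(hexc₁ : IsExcellentRing S₁)` (RULING 152c, res-L0-w41-tri-2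
`ls/audit_LS.md` N1); mechanism res-L0-w41-idea-3 `NT-DIRECT.md` §1 = `G-PERF-DIRECT.md` §2 (audited res-L0-w41-tri-2 `gpd/audit_GPERF_DIRECT.md` §1 PASS);
route res-D-pv-007 `NoSatelliteStep-PLAN.md` over his kit ((T0) p540019 · (Tsq) p539296 · (R) p537513 · (N) p538304 · K2 p536416/p535264) and this seat's
(W) p547304 · (Σ) p547869 · (F) helpers; replaces the role of no printed item; NOT a statement of the manuscript under review [claim: Hironaka2017,
status: under-review]; AI-produced, weaker than expert review). Theses-free, definition-free.

ARGUMENT (one window `S₀ ≤ S₁ ≤ S₂ ≤ S₃`, by contradiction from a SATELLITE second step): window coordinates (W) `𝔪₀ = (X, Y, Y_k)`, `𝔪₁ = (X, y, z_k)`,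
`𝔪₂ = (x′, y, w_k)`, `Y = Xy`, `Y_k = X z_k`, `X = x′y`, `z_k = w_k y`, `x₀ = X u₀`, `x₁ = y v` · Cohen expansions `E₁`, `E₂` of `S₁`, `S₂` adapted to these
parameters (T0) and the coefficient change `λ : κ(Ŝ₁) → κ(Ŝ₂)` (F) · the chart SQUARE `E₂ ∘ incl = λ_* ∘ θ_y ∘ E₁` (Tsq) · realisability of `S₀` in `E₁`
(R) ⇒ (α) `x^d F = H(x, xy, xz)` for `F := E₁(u₀^d f₁)` · (β) `F − G² ∈ 𝔪^d` from the law at `S₁ ≤ S₂` · (γ) `λ_*(θ_y F) = A² + y^d R` from the renormalised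
law at `S₂ ≤ S₃` · the support kill (Σ) ⇒ every odd monomial of `F` has `(x,z)`-degree `≥ 2` · (N) ⇒ the radicand of `F` over `κ(Ŝ₁)⟦X⟧` is not isolated ·
descent to `S₁` (excellence) and `RadicandRenorm.isolated_renorm` (`u₀^d f₁` vs `f₁`) contradict `hiso₁`.

* `NoSatelliteStep.exists_square_readings` — stage (F): the two expansions and the chart square;
* `NoSatelliteStep.exists_realisation` — stage (α): `S₀` read through `E₁` lands in `K⟦x, xy, xz⟧`;
* `NoSatelliteStep.reading_alpha_beta`, `NoSatelliteStep.reading_gamma` — the three constraints on `F = E₁(u₀^d f₁)`;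
* `NoSatelliteStep.span_excParam_eq_of_rational` — **(LS)**; `NoSatelliteStep.noTangentialStepPerfect_of_rational` — **(LS-word)** (res-L0-w41-tri-2's glue). [folklore]
-/

noncomputable section

set_option linter.dupNamespace false

open IsLocalRing MvPowerSeries
open Literature.AlgebraicGeometry.Resolution Literature.RingTheory.MvPowerSeries Literature.RingTheory.MvPowerSeries.monoidPowerSeries
open Summit.ResolutionOfSingularities.ResolutionOfSingularities.Theorems.SwitchingDichotomy
open Summit.ResolutionOfSingularities.ResolutionOfSingularities.Theorems.SwitchingDichotomy.SigmaTopLegality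
open Summit.ResolutionOfSingularities.ResolutionOfSingularities.Theorems.SwitchingDichotomy.NoTangentialStep
open Summit.ResolutionOfSingularities.ResolutionOfSingularities.Theorems.SwitchingDichotomy.ChartMonomialSubst

namespace Summit.ResolutionOfSingularities.ResolutionOfSingularities.Theorems.SwitchingDichotomy.NoSatelliteStep

variable {L : Type} [Field L] [CharP L 2]

/-! ## Stage (F): the two expansions and the chart square -/

/-- **The chart square at a satellite step, read in adapted Cohen expansions.** For regular local `S₁ ≤ S₂ ⊂ L` (dominated, `S₁` with perfect residue
field, dimension `m+2`) with parameters `(X, y, z_k)` of `S₁` and `(x′, y, w_k)` of `S₂` related by `X = x′y`, `z_k = w_k y`: expansions `E₁ = φ₁ ∘ (S₁ → Ŝ₁)`,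
`E₂` adapted to these parameters and a coefficient change `λ` with `E₂ (s) = λ_* (θ_y (E₁ s))` for every `s ∈ S₁` (`θ_y` = the chart substitution at the letter
`y`). (T0) `NoSatelliteStep.exists_expansion` + (F) `NoSatelliteFrames.exists_residue_hom` + (Tsq) `ExpansionTransport.ringHom_comp_eq_of_generators`. [folklore] -/
theorem exists_square_readings {m : ℕ} {S₁ S₂ : Subring L} [IsLocalRing S₁] [IsLocalRing S₂]
    (hreg₁ : IsRegularLocalRing S₁) (hreg₂ : IsRegularLocalRing S₂) (h₁₂ : S₁ ≤ S₂) (hdom : SubringDominates S₁ S₂)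
    (hdim₁ : ringKrullDim S₁ = (m + 2 : ℕ)) (hdim₂ : ringKrullDim S₂ = (m + 2 : ℕ))
    (hperf₁ : ∀ a : ResidueField S₁, ∃ b : ResidueField S₁, b ^ 2 = a)
    (x₁ : Fin (m + 2) → S₁) (hx₁ : Ideal.span (Set.range x₁) = maximalIdeal S₁)
    (x₂ : Fin (m + 2) → S₂) (hx₂ : Ideal.span (Set.range x₂) = maximalIdeal S₂)
    (h0 : Subring.inclusion h₁₂ (x₁ 0) = x₂ 0 * x₂ 1) (h1 : Subring.inclusion h₁₂ (x₁ 1) = x₂ 1)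
    (hk : ∀ k : Fin m, Subring.inclusion h₁₂ (x₁ k.succ.succ) = x₂ k.succ.succ * x₂ 1) :
    ∃ (φ₁ : AdicCompletion (maximalIdeal S₁) S₁ ≃+* MvPowerSeries (Fin (m + 2)) (ResidueField (AdicCompletion (maximalIdeal S₁) S₁)))
      (E₁ : S₁ →+* MvPowerSeries (Fin (m + 2)) (ResidueField (AdicCompletion (maximalIdeal S₁) S₁)))
      (lam : ResidueField (AdicCompletion (maximalIdeal S₁) S₁) →+* ResidueField (AdicCompletion (maximalIdeal S₂) S₂))
      (E₂ : S₂ →+* MvPowerSeries (Fin (m + 2)) (ResidueField (AdicCompletion (maximalIdeal S₂) S₂))),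
      (∀ s, E₁ s = φ₁ (algebraMap S₁ _ s)) ∧ (∀ i, E₁ (x₁ i) = X i) ∧ (∀ i, E₂ (x₂ i) = X i) ∧
      ∀ s : S₁, E₂ (Subring.inclusion h₁₂ s) = MvPowerSeries.map lam
        (substGenerators (R := ResidueField (AdicCompletion (maximalIdeal S₁) S₁))
          (fun i : Fin (m + 2) => Finsupp.single i 1 + if i = 1 then 0 else 1 • Finsupp.single 1 1) (chartExp_ne_zero 1 1) (E₁ s)) := by
  classical
  haveI := hreg₁
  haveI := hreg₂
  haveI : Fact (Nat.Prime 2) := ⟨Nat.prime_two⟩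
  haveI : CharP (AdicCompletion (maximalIdeal S₂) S₂) 2 := RadicandCohenFrame.charP_adicCompletion 2 S₂
  haveI : CharP (ResidueField (AdicCompletion (maximalIdeal S₂) S₂)) 2 := RadicandCohenFrame.charP_residueField 2
  obtain ⟨φ₁, E₁, hE₁φ, hE₁x, hE₁res⟩ := exists_expansion 2 hdim₁ x₁ hx₁
  obtain ⟨φ₂, E₂, hE₂φ, hE₂x, hE₂res⟩ := exists_expansion 2 hdim₂ x₂ hx₂
  obtain ⟨lam, hlam⟩ := NoSatelliteFrames.exists_residue_hom hdom
  refine ⟨φ₁, E₁, lam, E₂, hE₁φ, hE₁x, hE₂x, ?_⟩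
  -- the chart square by `ExpansionTransport.ringHom_comp_eq_of_generators`
  have hinj := expSum_chart_injective (σ := Fin (m + 2)) 1 1
  have hθX : ∀ i, substGenerators (R := ResidueField (AdicCompletion (maximalIdeal S₁) S₁))
      (fun i : Fin (m + 2) => Finsupp.single i 1 + if i = 1 then 0 else 1 • Finsupp.single 1 1) (chartExp_ne_zero 1 1) (X i) =
        monomial (Finsupp.single i 1 + if i = 1 then 0 else 1 • Finsupp.single 1 1) 1 := fun i => by
    rw [substGenerators_apply, subst_X (hasSubst_monomial _ (chartExp_ne_zero 1 1))]
  have hsq := ExpansionTransport.ringHom_comp_eq_of_generators 2 E₁ (E₂.comp (Subring.inclusion h₁₂))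
    ((MvPowerSeries.map lam).comp (substGenerators (R := ResidueField (AdicCompletion (maximalIdeal S₁) S₁))
      (fun i : Fin (m + 2) => Finsupp.single i 1 + if i = 1 then 0 else 1 • Finsupp.single 1 1) (chartExp_ne_zero 1 1)).toRingHom)
    lam hperf₁
    (fun c => by
      rw [RingHom.comp_apply, AlgHom.toRingHom_eq_coe, RingHom.coe_coe, substGenerators_apply, subst_C, map_C])
    (fun F hF => by
      rw [RingHom.comp_apply, AlgHom.toRingHom_eq_coe, RingHom.coe_coe, ← coeff_zero_eq_constantCoeff_apply, coeff_map,
        coeff_zero_eq_constantCoeff_apply, FreeChainBound.constantCoeff_substGenerators _ _ hinj, hF, map_zero])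
    (Finset.univ.image x₁) (by rw [Finset.coe_image, Finset.coe_univ, Set.image_univ, hx₁])
    (fun g hg => by
      obtain ⟨i, -, rfl⟩ := Finset.mem_image.mp hg
      rw [hE₁x, constantCoeff_X])
    (fun g hg => by
      obtain ⟨i, -, rfl⟩ := Finset.mem_image.mp hg
      rw [RingHom.comp_apply, AlgHom.toRingHom_eq_coe, RingHom.coe_coe, hE₁x, hθX, map_monomial, map_one, RingHom.comp_apply]
      refine Fin.cases ?_ (fun i => Fin.cases ?_ (fun k => ?_) i) i
      · rw [h0, map_mul, hE₂x, hE₂x, if_neg (Fin.zero_ne_one), one_smul, X_def, X_def, monomial_mul_monomial, one_mul]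
      · rw [Fin.succ_zero_eq_one, h1, hE₂x, if_pos rfl, add_zero, X_def]
      · rw [hk, map_mul, hE₂x, hE₂x, if_neg (Fin.succ_succ_ne_one k), one_smul, X_def, X_def, monomial_mul_monomial, one_mul])
    (fun s => by rw [hE₁res, hlam, RingHom.comp_apply, hE₂res])
  intro s
  have := congrArg (fun f => f s) hsq
  simpa only [RingHom.comp_apply, AlgHom.toRingHom_eq_coe, RingHom.coe_coe] using this.symm

/-! ## Stage (α): realisability of `S₀` through `E₁` -/

omit [CharP L 2] in
/-- **Realisability**: with window coordinates `𝔪₀ = (X, Y, Y_k)`, `Y = Xy`, `Y_k = X z_k` and an expansion `E₁` of `S₁` with `E₁(X, y, z_k) = (X₀, X₁, X_{k+2})`,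
every element of `S₀` is read as a series in `x, xy, x z_k`: `E₁(s) = H(x^g)` for the chart at the letter `x` (res-D-pv-007 (R)
`ChartRealisability.map_mem_monoidPowerSeries`, perfect `κ(S₀)`). [folklore] -/
theorem exists_realisation {m : ℕ} {S₀ S₁ : Subring L} [IsLocalRing S₀] [IsLocalRing S₁] (h₀₁ : S₀ ≤ S₁)
    (hperf₀ : ∀ a : ResidueField S₀, ∃ b : ResidueField S₀, b ^ 2 = a)
    {K : Type} [Field K] [CharP K 2] (E₁ : S₁ →+* MvPowerSeries (Fin (m + 2)) K)
    (X Y : S₀) (Yk : Fin m → S₀) (y : S₁) (z : Fin m → S₁)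
    (hgen₀ : Ideal.span (Set.range (Fin.cons X (Fin.cons Y Yk) : Fin (m + 2) → S₀)) = maximalIdeal S₀)
    (hY : Subring.inclusion h₀₁ Y = Subring.inclusion h₀₁ X * y) (hYk : ∀ k, Subring.inclusion h₀₁ (Yk k) = Subring.inclusion h₀₁ X * z k)
    (hEX : E₁ (Subring.inclusion h₀₁ X) = MvPowerSeries.X 0) (hEy : E₁ y = MvPowerSeries.X 1)
    (hEz : ∀ k : Fin m, E₁ (z k) = MvPowerSeries.X k.succ.succ) (s : S₀) :
    ∃ H : MvPowerSeries (Fin (m + 2)) K, substGenerators (R := K)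
      (fun i : Fin (m + 2) => Finsupp.single i 1 + if i = 0 then 0 else 1 • Finsupp.single 0 1) (chartExp_ne_zero 0 1) H =
        E₁ (Subring.inclusion h₀₁ s) := by
  classical
  haveI : Fact (Nat.Prime 2) := ⟨Nat.prime_two⟩
  have himg : ∀ i, E₁ (Subring.inclusion h₀₁ ((Fin.cons X (Fin.cons Y Yk) : Fin (m + 2) → S₀) i)) =
      monomial (Finsupp.single i 1 + if i = 0 then 0 else 1 • Finsupp.single 0 1) (1 : K) := by
    intro i
    refine Fin.cases ?_ (fun i => Fin.cases ?_ (fun k => ?_) i) i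
    · rw [Fin.cons_zero, hEX, if_pos rfl, add_zero, X_def]
    · rw [Fin.succ_zero_eq_one, Fin.cons_one, Fin.cons_zero, hY, map_mul, hEX, hEy, if_neg Fin.zero_ne_one.symm, one_smul, X_def, X_def,
        monomial_mul_monomial, one_mul, add_comm (Finsupp.single (0 : Fin (m + 2)) 1)]
    · rw [Fin.cons_succ, Fin.cons_succ, hYk, map_mul, hEX, hEz, if_neg (Fin.succ_ne_zero _), one_smul, X_def, X_def,
        monomial_mul_monomial, one_mul, add_comm (Finsupp.single (0 : Fin (m + 2)) 1)]
  have hmem := ChartRealisability.map_mem_monoidPowerSeries 2 (E₁.comp (Subring.inclusion h₀₁))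
    (AddSubmonoid.closure (Set.range fun i : Fin (m + 2) => Finsupp.single i 1 + if i = 0 then 0 else 1 • Finsupp.single 0 1))
    (Finset.univ.image (Fin.cons X (Fin.cons Y Yk) : Fin (m + 2) → S₀)) hperf₀
    (by rw [Finset.coe_image, Finset.coe_univ, Set.image_univ, hgen₀])
    (fun g hg => by
      obtain ⟨i, -, rfl⟩ := Finset.mem_image.mp hg
      rw [RingHom.comp_apply, himg]
      exact monoidPowerSeries.monomial_mem (AddSubmonoid.subset_closure (Set.mem_range_self
        (f := fun i : Fin (m + 2) => Finsupp.single i 1 + if i = 0 then 0 else 1 • Finsupp.single 0 1) i)) (1 : K))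
    (fun g hg => by
      obtain ⟨i, -, rfl⟩ := Finset.mem_image.mp hg
      rw [RingHom.comp_apply, himg, ← coeff_zero_eq_constantCoeff_apply, coeff_monomial, if_neg]
      exact fun h => chartExp_ne_zero 0 1 i h.symm) s
  exact exists_substGenerators_eq _ _ le_rfl hmem

/-! ## Stages (β) and (α) read on `F = E₁(u₀^(2e) f₁)`, and (γ) at the next member -/

omit [CharP L 2] in
/-- **(α) and (β) on `F := E₁(u₀^(2e)·f₁)`.** From the law `f₁ x₀^(2e) = f₀ − g₀²` with `x₀ = X u₀`, realisability of `S₀` and the order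
`f₁ − g₁² ∈ 𝔪₁^(2e)`: `x^(2e)·F = H(x^g)` for some `H`, and `F − G² ∈ 𝔪^(2e)` with `G := E₁(u₀^e g₁)`. [folklore] -/
theorem reading_alpha_beta {m e : ℕ} {S₀ S₁ : Subring L} [IsLocalRing S₀] [IsLocalRing S₁] (h₀₁ : S₀ ≤ S₁)
    {K : Type} [Field K] (E₁ : S₁ →+* MvPowerSeries (Fin (m + 2)) K)
    (x₁v : Fin (m + 2) → S₁) (hx₁v : Ideal.span (Set.range x₁v) = maximalIdeal S₁) (hE₁x : ∀ i, E₁ (x₁v i) = MvPowerSeries.X i)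
    (X : S₀) (hX0 : x₁v 0 = Subring.inclusion h₀₁ X)
    (hreal : ∀ s : S₀, ∃ H : MvPowerSeries (Fin (m + 2)) K, substGenerators (R := K)
      (fun i : Fin (m + 2) => Finsupp.single i 1 + if i = 0 then 0 else 1 • Finsupp.single 0 1) (chartExp_ne_zero 0 1) H =
        E₁ (Subring.inclusion h₀₁ s))
    (f₀ g₀ : S₀) (f₁ g₁ x₀ u₀ : S₁) (hx₀u : x₀ = Subring.inclusion h₀₁ X * u₀)
    (hlaw₀ : ((f₁ : S₁) : L) * ((x₀ : S₁) : L) ^ (2 * e) = ((f₀ : S₀) : L) - ((g₀ : S₀) : L) ^ 2)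
    (hA1 : f₁ - g₁ ^ 2 ∈ maximalIdeal S₁ ^ (2 * e)) :
    (∃ H : MvPowerSeries (Fin (m + 2)) K, MvPowerSeries.X 0 ^ (2 * e) * E₁ (u₀ ^ (2 * e) * f₁) = substGenerators (R := K)
      (fun i : Fin (m + 2) => Finsupp.single i 1 + if i = 0 then 0 else 1 • Finsupp.single 0 1) (chartExp_ne_zero 0 1) H) ∧
    E₁ (u₀ ^ (2 * e) * f₁) - E₁ (u₀ ^ e * g₁) ^ 2 ∈ maximalIdeal (MvPowerSeries (Fin (m + 2)) K) ^ (2 * e) := by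
  refine ⟨?_, ?_⟩
  · obtain ⟨H, hH⟩ := hreal (f₀ - g₀ ^ 2)
    refine ⟨H, ?_⟩
    have hS₁ : Subring.inclusion h₀₁ (f₀ - g₀ ^ 2) = (Subring.inclusion h₀₁ X) ^ (2 * e) * (u₀ ^ (2 * e) * f₁) := Subtype.ext (by
      have hx : ((x₀ : S₁) : L) = (X : L) * (u₀ : L) := by rw [hx₀u, Subring.coe_mul, Subring.coe_inclusion]
      push_cast [Subring.coe_inclusion]
      rw [← hlaw₀, hx]; ring)
    have hE : E₁ ((Subring.inclusion h₀₁ X) ^ (2 * e) * (u₀ ^ (2 * e) * f₁)) =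
        MvPowerSeries.X 0 ^ (2 * e) * E₁ (u₀ ^ (2 * e) * f₁) := by
      rw [map_mul, map_pow, ← hX0, hE₁x]
    rw [hH, hS₁, hE]
  · have hmem : u₀ ^ (2 * e) * f₁ - (u₀ ^ e * g₁) ^ 2 ∈ maximalIdeal S₁ ^ (2 * e) := by
      have : u₀ ^ (2 * e) * f₁ - (u₀ ^ e * g₁) ^ 2 = u₀ ^ (2 * e) * (f₁ - g₁ ^ 2) := by ring
      rw [this]; exact Ideal.mul_mem_left _ _ hA1
    have := NoSatelliteFrames.map_mem_pow_of_generators E₁ x₁v hx₁v hE₁x hmem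
    rwa [map_sub, map_pow] at this

/-- **(γ) at the next member.** From the law `f₂ x₁^(2e) = f₁ − g₁²` with `x₁ = y v`, the order `f₂ − g₂² ∈ 𝔪₂^(2e)` and the renormalised law
(`NoSatelliteFrames.renorm_law`): `E₂ (u₀^(2e) f₁) = A² + X₁^(2e)·R` with `R ∈ 𝔪^(2e)`, for any expansion `E₂` of `S₂` adapted to parameters whose letter
`1` is `y`. [folklore] -/
theorem reading_gamma {m e : ℕ} {S₁ S₂ : Subring L} [IsLocalRing S₁] [IsLocalRing S₂] (h₁₂ : S₁ ≤ S₂)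
    {K' : Type} [Field K'] (E₂ : S₂ →+* MvPowerSeries (Fin (m + 2)) K')
    (x₂v : Fin (m + 2) → S₂) (hx₂v : Ideal.span (Set.range x₂v) = maximalIdeal S₂) (hE₂x : ∀ i, E₂ (x₂v i) = MvPowerSeries.X i)
    (y : S₁) (hy1 : x₂v 1 = Subring.inclusion h₁₂ y)
    (f₁ g₁ u₀ : S₁) (f₂ g₂ x₁ v : S₂) (hx₁v : x₁ = Subring.inclusion h₁₂ y * v)
    (hlaw₁ : ((f₂ : S₂) : L) * ((x₁ : S₂) : L) ^ (2 * e) = ((f₁ : S₁) : L) - ((g₁ : S₁) : L) ^ 2)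
    (hA2 : f₂ - g₂ ^ 2 ∈ maximalIdeal S₂ ^ (2 * e)) :
    ∃ A R : MvPowerSeries (Fin (m + 2)) K', R ∈ maximalIdeal (MvPowerSeries (Fin (m + 2)) K') ^ (2 * e) ∧
      E₂ (Subring.inclusion h₁₂ (u₀ ^ (2 * e) * f₁)) = A ^ 2 + MvPowerSeries.X 1 ^ (2 * e) * R := by
  have hlaw₁' : f₂ * x₁ ^ (2 * e) = Subring.inclusion h₁₂ f₁ - Subring.inclusion h₁₂ g₁ ^ 2 := Subtype.ext (by
    push_cast [Subring.coe_inclusion]; exact hlaw₁)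
  have hid := NoSatelliteFrames.renorm_law (Subring.inclusion h₁₂ f₁) (Subring.inclusion h₁₂ g₁) f₂ g₂ x₁ (Subring.inclusion h₁₂ y) v
    (Subring.inclusion h₁₂ u₀) e hlaw₁' hx₁v
  refine ⟨E₂ (Subring.inclusion h₁₂ u₀ ^ e * Subring.inclusion h₁₂ g₁ + Subring.inclusion h₁₂ y ^ e *
      (v ^ e * Subring.inclusion h₁₂ u₀ ^ e * g₂)),
    E₂ ((v ^ e * Subring.inclusion h₁₂ u₀ ^ e) ^ 2 * (f₂ - g₂ ^ 2)), ?_, ?_⟩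
  · exact NoSatelliteFrames.map_mem_pow_of_generators E₂ x₂v hx₂v hE₂x (Ideal.mul_mem_left _ _ hA2)
  · rw [map_mul, map_pow, hid, map_add, map_pow, map_mul, map_pow, ← hy1, hE₂x]

/-! ## (LS) — Lemma S, one window -/

/-- **(LS) LEMMA S — NO SATELLITE STEP.** One window `S₀ ≤ S₁ ≤ S₂ ≤ S₃` of quadratic transforms of regular local subrings of dimension `c ≥ 2` in
characteristic `2`, radicand laws of constant exponent `2e ≥ 4`, perfect `κ(S₀)`, `S₁` excellent, isolated torsor germ at `S₁`, RATIONAL centres at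
`S₁` and `S₂`: then the second step is NOT a satellite step — `(x₀) = (x₁)` in `S₂`. Signature = res-D-pv-004/pv-007's (LS) with `(hexc₁ : IsExcellentRing S₁)`
added after `hperf₀` (res-L0-w41-plan-1 RULING 152c). [folklore] -/
theorem span_excParam_eq_of_rational (c e : ℕ) (hc : 2 ≤ c) (he : 2 ≤ e)
    {S₀ S₁ S₂ S₃ : Subring L} [IsLocalRing S₀] [IsLocalRing S₁] [IsLocalRing S₂] [IsLocalRing S₃]
    (h₀₁ : S₀ ≤ S₁) (h₁₂ : S₁ ≤ S₂) (h₂₃ : S₂ ≤ S₃)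
    (hreg₀ : IsRegularLocalRing S₀) (hreg₁ : IsRegularLocalRing S₁) (hreg₂ : IsRegularLocalRing S₂)
    (hdim₀ : ringKrullDim S₀ = c) (hdim₁ : ringKrullDim S₁ = c) (hdim₂ : ringKrullDim S₂ = c)
    (hqt₀ : IsQuadraticTransform S₀ S₁) (hqt₁ : IsQuadraticTransform S₁ S₂) (hqt₂ : IsQuadraticTransform S₂ S₃)
    (f₀ g₀ : S₀) (f₁ g₁ : S₁) (f₂ g₂ : S₂) (f₃ : S₃) (x₀ : S₁) (x₁ : S₂) (x₂ : S₃)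
    (hx₀ : Ideal.span ((fun y : S₀ => (⟨(y : L), h₀₁ y.2⟩ : S₁)) '' (maximalIdeal S₀ : Set S₀)) = Ideal.span {x₀})
    (hx₁ : Ideal.span ((fun y : S₁ => (⟨(y : L), h₁₂ y.2⟩ : S₂)) '' (maximalIdeal S₁ : Set S₁)) = Ideal.span {x₁})
    (hx₂ : Ideal.span ((fun y : S₂ => (⟨(y : L), h₂₃ y.2⟩ : S₃)) '' (maximalIdeal S₂ : Set S₂)) = Ideal.span {x₂})
    (hlaw₀ : ((f₁ : S₁) : L) * ((x₀ : S₁) : L) ^ (2 * e) = ((f₀ : S₀) : L) - ((g₀ : S₀) : L) ^ 2)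
    (hlaw₁ : ((f₂ : S₂) : L) * ((x₁ : S₂) : L) ^ (2 * e) = ((f₁ : S₁) : L) - ((g₁ : S₁) : L) ^ 2)
    (hlaw₂ : ((f₃ : S₃) : L) * ((x₂ : S₃) : L) ^ (2 * e) = ((f₂ : S₂) : L) - ((g₂ : S₂) : L) ^ 2)
    (hperf₀ : PerfectField (ResidueField S₀)) (hexc₁ : IsExcellentRing S₁)
    (hiso₁ : HasIsolatedSingularity (RadicandRing S₁ 2 f₁))
    (hrat₀ : ∀ z : S₁, ∃ s : S₀, z - ⟨(s : L), h₀₁ s.2⟩ ∈ maximalIdeal S₁)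
    (hrat₁ : ∀ z : S₂, ∃ s : S₁, z - ⟨(s : L), h₁₂ s.2⟩ ∈ maximalIdeal S₂) :
    Ideal.span {(⟨((x₀ : S₁) : L), h₁₂ x₀.2⟩ : S₂)} = Ideal.span {x₁} := by
  classical
  haveI : Fact (Nat.Prime 2) := ⟨Nat.prime_two⟩
  haveI := hreg₀
  haveI := hreg₁
  haveI := hreg₂
  haveI := hperf₀
  by_contra hsat
  obtain ⟨m, rfl⟩ : ∃ m, c = m + 2 := ⟨c - 2, by omega⟩
  have hdom₀ : SubringDominates S₀ S₁ := hqt₀.dominates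
  have hdom₁ : SubringDominates S₁ S₂ := hqt₁.dominates
  -- ### (W) window coordinates
  obtain ⟨X, Y, Yk, y, z, x', w, u₀, v, hu₀, hv, hx₀u, hx₁v, hgen₀, hgen₁, hgen₂, hY, hYk, hXrel, hzrel⟩ :=
    NoSatelliteWindow.exists_window h₀₁ h₁₂ hreg₀ hdim₀ hqt₀ hqt₁ x₀ x₁ hx₀ hx₁ hrat₀ hrat₁ hsat
  -- ### residue fields: `κ(S₀)`, `κ(S₁)` perfect
  have hperf₀' : ∀ a : ResidueField S₀, ∃ b : ResidueField S₀, b ^ 2 = a := by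
    haveI : CharP (ResidueField S₀) 2 := RadicandCohenFrame.charP_residueField 2
    haveI : ExpChar (ResidueField S₀) 2 := ExpChar.prime Nat.prime_two
    intro a; obtain ⟨b, hb⟩ := surjective_frobenius (ResidueField S₀) 2 a; exact ⟨b, hb⟩
  have hperf₁ : ∀ a : ResidueField S₁, ∃ b : ResidueField S₁, b ^ 2 = a := NoSatelliteFrames.exists_sq_eq_of_rational hdom₀ hperf₀' hrat₀
  -- ### (F) expansions and the chart square
  obtain ⟨φ₁, E₁, lam, E₂, hE₁φ, hE₁x, hE₂x, hsq⟩ := exists_square_readings hreg₁ hreg₂ h₁₂ hdom₁ hdim₁ hdim₂ hperf₁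
    (Fin.cons (Subring.inclusion h₀₁ X) (Fin.cons y z)) hgen₁ (Fin.cons x' (Fin.cons (Subring.inclusion h₁₂ y) w)) hgen₂
    (by rw [Fin.cons_zero, Fin.cons_zero, Fin.cons_one, Fin.cons_zero]; exact hXrel) (by rw [Fin.cons_one, Fin.cons_one, Fin.cons_zero, Fin.cons_zero])
    (fun k => by rw [Fin.cons_succ, Fin.cons_succ, Fin.cons_succ, Fin.cons_succ, Fin.cons_one, Fin.cons_zero]; exact hzrel k)
  -- the residue field of `Ŝ₁` is perfect of characteristic `2`
  haveI : CharP (ResidueField S₁) 2 := RadicandCohenFrame.charP_residueField 2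
  haveI : ExpChar (ResidueField S₁) 2 := ExpChar.prime Nat.prime_two
  haveI : PerfectRing (ResidueField S₁) 2 := PerfectRing.ofSurjective _ 2 fun a => by
    obtain ⟨b, hb⟩ := hperf₁ a; exact ⟨b, hb⟩
  haveI : PerfectField (ResidueField S₁) := PerfectRing.toPerfectField _ 2
  haveI : CharP (AdicCompletion (maximalIdeal S₁) S₁) 2 := RadicandCohenFrame.charP_adicCompletion 2 S₁
  haveI : CharP (ResidueField (AdicCompletion (maximalIdeal S₁) S₁)) 2 := RadicandCohenFrame.charP_residueField 2
  haveI : PerfectField (ResidueField (AdicCompletion (maximalIdeal S₁) S₁)) := (IsolatedColength.exists_cohenIso_perfect 2 S₁).1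
  haveI : ExpChar (ResidueField (AdicCompletion (maximalIdeal S₁) S₁)) 2 := ExpChar.prime Nat.prime_two
  -- ### (α) realisability, (β), (γ)
  have hE₁X : E₁ (Subring.inclusion h₀₁ X) = MvPowerSeries.X 0 := by
    have := hE₁x 0; rwa [Fin.cons_zero] at this
  have hE₁y : E₁ y = MvPowerSeries.X 1 := by
    have := hE₁x 1; rwa [Fin.cons_one, Fin.cons_zero] at this
  have hE₁z : ∀ k : Fin m, E₁ (z k) = MvPowerSeries.X k.succ.succ := fun k => by
    have := hE₁x k.succ.succ; rwa [Fin.cons_succ, Fin.cons_succ] at this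
  have hreal := exists_realisation h₀₁ hperf₀' E₁ X Y Yk y z hgen₀ hY hYk hE₁X hE₁y hE₁z
  have hA1₁ := CleaningOptimal.sub_pow_mem_pow_of_law 2 hreg₁ hqt₁ h₁₂ f₁ g₁ f₂ x₁ e hx₁ hlaw₁
  have hA1₂ := CleaningOptimal.sub_pow_mem_pow_of_law 2 hreg₂ hqt₂ h₂₃ f₂ g₂ f₃ x₂ e hx₂ hlaw₂
  obtain ⟨⟨H, hα⟩, hβ⟩ := reading_alpha_beta h₀₁ E₁ _ hgen₁ hE₁x X (Fin.cons_zero _ _) hreal f₀ g₀ f₁ g₁ x₀ u₀ hx₀u hlaw₀ hA1₁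
  obtain ⟨A, R, hR, hγ⟩ := reading_gamma h₁₂ E₂ _ hgen₂ hE₂x y (by rw [Fin.cons_one, Fin.cons_zero]) f₁ g₁ u₀ f₂ g₂ x₁ v hx₁v hlaw₁ hA1₂
  rw [hsq] at hγ
  -- ### (Σ) support kill and (N)
  haveI : CharP (AdicCompletion (maximalIdeal S₂) S₂) 2 := RadicandCohenFrame.charP_adicCompletion 2 S₂
  haveI : CharP (ResidueField (AdicCompletion (maximalIdeal S₂) S₂)) 2 := RadicandCohenFrame.charP_residueField 2
  have hsupp := NoSatelliteSupport.odd_support_of_window (by omega : 4 ≤ 2 * e) lam hα hβ hR hγ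
  have hN := not_hasIsolatedSingularity_of_odd_support (K := ResidueField (AdicCompletion (maximalIdeal S₁) S₁))
    ((Finset.univ : Finset (Fin (m + 2))).erase 1) (by rw [Finset.card_erase_of_mem (Finset.mem_univ _), Finset.card_univ, Fintype.card_fin]; omega)
    (E₁ (u₀ ^ (2 * e) * f₁)) hsupp
  rw [hE₁φ] at hN
  -- ### descent to `S₁` and the square-unit renormalisation
  have hN' := not_hasIsolatedSingularity_of_ringEquiv_adicCompletion 2 hexc₁ (u₀ ^ (2 * e) * f₁) φ₁ hN
  apply hN'
  exact RadicandRenorm.isolated_renorm 2 (hu₀.pow e) (w := 0) (by ring) hiso₁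

/-- **(LS-word)** `NoTangentialStepPerfect 2 c (2e)` for `c ≥ 2`, `e ≥ 2`, GIVEN rational centres, the non-rational windows being supplied by the binder
`hK3` (finite étale coefficient extension; res-L0-w41-idea-3 G-PERF-DIRECT §4). Glue of res-L0-w41-tri-2 (`ls/LS_glue.lean`) verbatim up to `hexc (m+1)`.
[folklore] -/
theorem noTangentialStepPerfect_of_rational (c e : ℕ) (hc : 2 ≤ c) (he : 2 ≤ e)
    (hK3 : ∀ (L : Type) [Field L] [CharP L 2] (S : ℕ → Subring L) [∀ m, IsLocalRing (S m)]
      (hle : ∀ m, S m ≤ S (m + 1)) (f g : ∀ m, S m) (x : ∀ m, S (m + 1)),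
      (∀ m, IsRegularLocalRing (S m)) → (∀ m, IsExcellentRing (S m)) → (∀ m, ringKrullDim (S m) = c) →
      (∀ m, IsQuadraticTransform (S m) (S (m + 1))) →
      (∀ m, Ideal.span ((fun y : S m => (⟨(y : L), hle m y.2⟩ : S (m + 1))) '' (maximalIdeal (S m) : Set (S m)))
          = Ideal.span {x m}) →
      (∀ m, ((f (m + 1) : S (m + 1)) : L) * ((x m : S (m + 1)) : L) ^ (2 * e) =
          ((f m : S m) : L) - ((g m : S m) : L) ^ 2) →
      (∀ m, PerfectField (IsLocalRing.ResidueField (S m))) →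
      (∀ m, HasIsolatedSingularity (RadicandRing (S m) 2 (f m))) →
      ∀ m, ((¬ ∀ z : S (m + 1), ∃ s : S m, z - ⟨(s : L), hle m s.2⟩ ∈ maximalIdeal (S (m + 1))) ∨
            (¬ ∀ z : S (m + 2), ∃ s : S (m + 1), z - ⟨(s : L), hle (m + 1) s.2⟩ ∈ maximalIdeal (S (m + 2)))) →
        Ideal.span {(⟨((x m : S (m + 1)) : L), hle (m + 1) (x m).2⟩ : S (m + 2))} = Ideal.span {x (m + 1)}) :
    NoTangentialStepPerfect 2 c (2 * e) := by
  intro L _ _ S _ hle f g x hreg hexc hdim hqt hx hlaw _hinit _hord _hder hperf hiso m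
  by_cases hrat : (∀ z : S (m + 1), ∃ s : S m, z - ⟨(s : L), hle m s.2⟩ ∈ maximalIdeal (S (m + 1))) ∧
      (∀ z : S (m + 2), ∃ s : S (m + 1), z - ⟨(s : L), hle (m + 1) s.2⟩ ∈ maximalIdeal (S (m + 2)))
  · exact span_excParam_eq_of_rational c e hc he (hle m) (hle (m + 1)) (hle (m + 2))
      (hreg m) (hreg (m + 1)) (hreg (m + 2)) (hdim m) (hdim (m + 1)) (hdim (m + 2))
      (hqt m) (hqt (m + 1)) (hqt (m + 2)) (f m) (g m) (f (m + 1)) (g (m + 1)) (f (m + 2)) (g (m + 2)) (f (m + 3))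
      (x m) (x (m + 1)) (x (m + 2)) (hx m) (hx (m + 1)) (hx (m + 2)) (hlaw m) (hlaw (m + 1)) (hlaw (m + 2))
      (hperf m) (hexc (m + 1)) (hiso (m + 1)) hrat.1 hrat.2
  · exact hK3 L S hle f g x hreg hexc hdim hqt hx hlaw hperf hiso m (by
      rcases not_and_or.mp hrat with h | h
      · exact Or.inl h
      · exact Or.inr h)

end Summit.ResolutionOfSingularities.ResolutionOfSingularities.Theorems.SwitchingDichotomy.NoSatelliteStep

end
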